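import Summits.Ventures.CertifiedManyBodySolver.Rows.CARPolyWindowSyntax
import Literature.MathematicalPhysics.QuantumLattice.HubbardTTPrimeBoxHamiltonian
import HarnessLib

/-!
# DICTIONARIES for the kernel form of the window-certificate soundness: the `t–t'` WINDOW HAMILTONIAN `H^{t,t',U}_{Λ'}` as a
# syntactic term list over indexed site letters (`termOp_hamTermsIdx`)

HONEST FRAMING: Lean plumbing towards «tier P» (no claim node discharged, no number); the rows this serves are CONTROL/CALIBRATION
stiffness-scale CEILINGS (wording (xx1)), silent on the presence of superconductivity; not a `T_c` or phase sentence; no summit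
statement is proved by this file. Seat hubbard-obs-p2 (STIFFNESS), `prover-hubbard-obs-p2-g22-0`, zero compute.

`Rows/CorrWindowCertKernelForm.lean` (`affineOrbitLowerRowN_of_kernelCert`) turns a SYNTACTIC window certificate into the affine-N
claim-node predicate given two DICTIONARY hypotheses: `termOp d TH = (hubbardTTPrimeFermionInteraction 1 tp U).localHamiltonian Λ'`
and `termOp d TE = Γ(incl) E_Φ`. This file discharges the FIRST once and for all, for every window: with the sites of `Λ'` enumerated
by `xs : Fin N → Site 2` (injective, covering `Λ'`) and the letter map `d (i, σ) = (xs i, σ)`, the computable list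
`hamTermsIdx t tp U xs` — hopping `−t` along every nearest-neighbour ordered pair inside `Λ'`, `−tp` along every diagonal ordered pair,
`U n_{x↑} n_{x↓}` at every site (adjacency decided on the integer coordinates) — denotes `H^{t,tp,U}_{Λ'}` (`termOp_hamTermsIdx`; via
the tree's `hubbardTTPrime_localHamiltonian_eq_twoGraph` = `hamiltonian (polyGraph Λ') t U + hamiltonian G' tp 0` with the diagonal
graph `polyDiagGraph Λ'` built here by `SimpleGraph.fromRel`). Everything is PROVED (0 sorry).

References: H. Xu et al., Science 384 (2024) eadh7691, eq. (1) (the `t–t'` Hubbard Hamiltonian) [XuEtAl2024]; X. Han, arXiv:2006.06002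
§3 [Han2020Bootstrap].
-/

noncomputable section

namespace Summit.Ventures.CertifiedManyBodySolver

namespace CARPolyWindow

open Summit.Ventures.CertifiedQuantumChemistry Summit.Ventures.CertifiedQuantumChemistry.CARPoly
open Literature.MathematicalPhysics.QuantumLattice Literature.MathematicalPhysics.QuantumLattice.HubbardWave0
open Literature.Probability.LatticeModels
open Matrix
open scoped ComplexOrder BigOperators

/-! ## The diagonal adjacency and its graph on a window -/

/-- Diagonal (next-nearest-neighbour) adjacency test of two sites of `ℤ²`: `y = x ± (1, ±1)` (a Boolean, decided on the
integer coordinates). [cite: XuEtAl2024, eq. (1)] -/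
def diagAdjB (x y : Site 2) : Bool := decide ((∃ s : Fin 2, y = x + diagVec s) ∨ ∃ s : Fin 2, x = y + diagVec s)

/-- `diagAdjB` decides the diagonal adjacency. [folklore] -/
theorem diagAdjB_eq_true_iff (x y : Site 2) :
    diagAdjB x y = true ↔ ((∃ s : Fin 2, y = x + diagVec s) ∨ ∃ s : Fin 2, x = y + diagVec s) := by
  rw [diagAdjB, decide_eq_true_iff]

/-- The diagonal graph on the sites of a window `Λ'`. [cite: XuEtAl2024, eq. (1)] -/
def polyDiagGraph (Λ' : Finset (Site 2)) : SimpleGraph (PolySite Λ') :=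
  SimpleGraph.fromRel fun a b => ∃ s : Fin 2, ofLex b.1 = ofLex a.1 + diagVec s

/-- Adjacency in `polyDiagGraph` is the diagonal adjacency of the coordinates. [cite: XuEtAl2024, eq. (1)] -/
theorem polyDiagGraph_adj {Λ' : Finset (Site 2)} (a b : PolySite Λ') :
    (polyDiagGraph Λ').Adj a b ↔
      ((∃ s : Fin 2, ofLex b.1 = ofLex a.1 + diagVec s) ∨ ∃ s : Fin 2, ofLex a.1 = ofLex b.1 + diagVec s) := by
  rw [polyDiagGraph, SimpleGraph.fromRel_adj]
  constructor
  · exact fun h => h.2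
  · intro h
    refine ⟨fun hab => ?_, h⟩
    subst hab
    rcases h with ⟨s, hs⟩ | ⟨s, hs⟩
    · exact self_ne_add_diagVec _ s hs
    · exact self_ne_add_diagVec _ s hs

/-! ## The syntactic window Hamiltonian -/

section Syntax

variable {N : ℕ}

/-- One hopping term list `Σ_σ c · a†_{iσ} a_{jσ}` (letters `Orb (Fin N)`). [cite: XuEtAl2024, eq. (1)] -/
def hopT (i j : Fin N) (c : ℚ) : Terms (Orb (Fin N)) :=
  (finL 2).flatMap fun σ => [([(orb i σ, true), (orb j σ, false)], c)]

/-- **The `t–t'` window Hamiltonian as a term list over indexed site letters**: for the site enumeration `xs : Fin N → ℤ²`,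
`Σ_{i,j} ([xs i ~ xs j] Σ_σ (−t) a†_{iσ}a_{jσ} + [xs i ~' xs j] Σ_σ (−tp) a†_{iσ}a_{jσ}) + Σ_i U a†_{i↑}a_{i↑}a†_{i↓}a_{i↓}`
(`~` nearest, `~'` diagonal neighbours; ordered pairs, so each bond appears with its Hermitian conjugate). [cite: XuEtAl2024, eq. (1)] -/
def hamTermsIdx (t tp U : ℚ) (xs : Fin N → Site 2) : Terms (Orb (Fin N)) :=
  ((finL N).flatMap fun i => (finL N).flatMap fun j =>
      (if (zdGraph 2).Adj (xs i) (xs j) then hopT i j (-t) else []) ++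
        (if diagAdjB (xs i) (xs j) then hopT i j (-tp) else [])) ++
    (finL N).flatMap fun i => [([(orb i 0, true), (orb i 0, false), (orb i 1, true), (orb i 1, false)], U)]

end Syntax

/-! ## The dictionary theorem -/

section Dictionary

variable {N : ℕ} {Λ' : Finset (Site 2)}

/-- A hopping list denotes `Σ_σ c • a†_{(xs i)σ} a_{(xs j)σ}`. [cite: XuEtAl2024, eq. (1)] -/
theorem termOp_hopT (xs : Fin N → Site 2) (hmem : ∀ i, xs i ∈ Λ') (d : Orb (Fin N) → Orb (PolySite Λ'))
    (hd : ∀ i σ, d (orb i σ) = orb (PolySite.pt (xs i) (hmem i)) σ) (i j : Fin N) (c : ℚ) :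
    termOp d (hopT i j c) = ∑ σ : Fin 2, ((c : ℚ) : ℂ) •
      (creation (orb (PolySite.pt (xs i) (hmem i)) σ) * annihilation (orb (PolySite.pt (xs j) (hmem j)) σ)) := by
  rw [hopT, termOp_flatMap_finL]
  refine Finset.sum_congr rfl fun σ _ => ?_
  rw [termOp_cons, termOp_nil, add_zero]
  congr 1
  simp only [wmap, List.map_cons, List.map_nil, ladderWord_cons, ladderWord_nil, mul_one, ladderLetter, if_true,
    Bool.false_eq_true, if_false, hd]

/-- `termOp` of an `if`. [folklore] -/
theorem termOp_ite {α ι : Type*} [LinearOrder ι] [Fintype ι] (d : α → ι) (b : Prop) [Decidable b] (T : Terms α) :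
    termOp d (if b then T else []) = if b then termOp d T else 0 := by
  split_ifs <;> simp

/-- The on-site word denotes `U • n_{x↑} n_{x↓}`. [cite: XuEtAl2024, eq. (1)] -/
theorem termOp_onSite (xs : Fin N → Site 2) (hmem : ∀ i, xs i ∈ Λ') (d : Orb (Fin N) → Orb (PolySite Λ'))
    (hd : ∀ i σ, d (orb i σ) = orb (PolySite.pt (xs i) (hmem i)) σ) (i : Fin N) (U : ℚ) :
    termOp d [([(orb i 0, true), (orb i 0, false), (orb i 1, true), (orb i 1, false)], U)] =
      ((U : ℚ) : ℂ) • (numberOp (PolySite.pt (xs i) (hmem i)) 0 * numberOp (PolySite.pt (xs i) (hmem i)) 1) := by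
  rw [termOp_cons, termOp_nil, add_zero]
  congr 1
  simp only [wmap, List.map_cons, List.map_nil, ladderWord_cons, ladderWord_nil, mul_one, ladderLetter, if_true,
    Bool.false_eq_true, if_false, hd, numberOp, mul_assoc]

/-- **DICTIONARY: the indexed term list IS the `t–t'` window Hamiltonian.** For an injective enumeration `xs : Fin N → ℤ²` of
the sites of `Λ'` and the letter map `d (i, σ) = (xs i, σ)`:
`termOp d (hamTermsIdx t tp U xs) = (hubbardTTPrimeFermionInteraction t tp U).localHamiltonian Λ'`. [cite: XuEtAl2024, eq. (1)] -/
theorem termOp_hamTermsIdx (t tp U : ℚ) (xs : Fin N → Site 2) (hmem : ∀ i, xs i ∈ Λ') (hinj : Function.Injective xs)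
    (hcov : ∀ y ∈ Λ', ∃ i, xs i = y) (d : Orb (Fin N) → Orb (PolySite Λ'))
    (hd : ∀ i σ, d (orb i σ) = orb (PolySite.pt (xs i) (hmem i)) σ) :
    termOp d (hamTermsIdx t tp U xs) =
      (hubbardTTPrimeFermionInteraction (t : ℝ) (tp : ℝ) (U : ℝ)).localHamiltonian Λ' := by
  classical
  -- the site bijection `Fin N ≃ PolySite Λ'`
  set e : Fin N → PolySite Λ' := fun i => PolySite.pt (xs i) (hmem i) with he
  have hebij : Function.Bijective e := by
    refine ⟨fun i j hij => hinj ?_, fun y => ?_⟩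
    · have := congrArg (fun p : PolySite Λ' => ofLex p.1) hij
      simpa [he] using this
    · obtain ⟨i, hi⟩ := hcov (ofLex y.1) (PolySite.ofLex_mem y)
      refine ⟨i, ?_⟩
      rw [he]
      dsimp only
      have : PolySite.pt (ofLex y.1) (PolySite.ofLex_mem y) = y := PolySite.pt_ofLex y
      convert this using 2
  -- the two-graph form of the local Hamiltonian
  rw [hubbardTTPrime_localHamiltonian_eq_twoGraph (tp : ℝ) (t : ℝ) (U : ℝ) Λ' (polyDiagGraph Λ') polyDiagGraph_adj,
    hamiltonian, hamiltonian, Complex.ofReal_zero, zero_smul, add_zero, hamTermsIdx, termOp_append, termOp_flatMap_finL,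
    termOp_flatMap_finL]
  -- hopping parts
  have hhop : ∑ i : Fin N, termOp d ((finL N).flatMap fun j =>
        (if (zdGraph 2).Adj (xs i) (xs j) then hopT i j (-t) else []) ++
          (if diagAdjB (xs i) (xs j) then hopT i j (-tp) else [])) =
      -(((t : ℚ) : ℝ) : ℂ) • ∑ x : PolySite Λ', ∑ y : PolySite Λ', ∑ σ : Fin 2,
          (if (polyGraph Λ').Adj x y then creation (orb x σ) * annihilation (orb y σ) else 0) +
        -(((tp : ℚ) : ℝ) : ℂ) • ∑ x : PolySite Λ', ∑ y : PolySite Λ', ∑ σ : Fin 2,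
          (if (polyDiagGraph Λ').Adj x y then creation (orb x σ) * annihilation (orb y σ) else 0) := by
    rw [Finset.smul_sum, Finset.smul_sum, ← Finset.sum_add_distrib]
    rw [← hebij.sum_comp (fun x => (-(((t : ℚ) : ℝ) : ℂ) • ∑ y : PolySite Λ', ∑ σ : Fin 2,
          (if (polyGraph Λ').Adj x y then creation (orb x σ) * annihilation (orb y σ) else 0)) +
        (-(((tp : ℚ) : ℝ) : ℂ) • ∑ y : PolySite Λ', ∑ σ : Fin 2,
          (if (polyDiagGraph Λ').Adj x y then creation (orb x σ) * annihilation (orb y σ) else 0)))]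
    refine Finset.sum_congr rfl fun i _ => ?_
    rw [termOp_flatMap_finL, Finset.smul_sum, Finset.smul_sum, ← Finset.sum_add_distrib]
    rw [← hebij.sum_comp (fun y => (-(((t : ℚ) : ℝ) : ℂ) • ∑ σ : Fin 2,
          (if (polyGraph Λ').Adj (e i) y then creation (orb (e i) σ) * annihilation (orb y σ) else 0)) +
        (-(((tp : ℚ) : ℝ) : ℂ) • ∑ σ : Fin 2,
          (if (polyDiagGraph Λ').Adj (e i) y then creation (orb (e i) σ) * annihilation (orb y σ) else 0)))]
    refine Finset.sum_congr rfl fun j _ => ?_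
    rw [termOp_append, termOp_ite, termOp_ite, termOp_hopT xs hmem d hd, termOp_hopT xs hmem d hd]
    have hadj1 : (polyGraph Λ').Adj (e i) (e j) ↔ (zdGraph 2).Adj (xs i) (xs j) := by
      rw [polyGraph_adj, he]
      simp only [PolySite.ofLex_coe_pt]
    have hadj2 : (polyDiagGraph Λ').Adj (e i) (e j) ↔ diagAdjB (xs i) (xs j) = true := by
      rw [polyDiagGraph_adj, he, diagAdjB_eq_true_iff]
      simp only [PolySite.ofLex_coe_pt]
    have ec1 : (((-t : ℚ)) : ℂ) = -(((t : ℚ) : ℝ) : ℂ) := by rw [Rat.cast_neg, Complex.ofReal_ratCast]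
    have ec2 : (((-tp : ℚ)) : ℂ) = -(((tp : ℚ) : ℝ) : ℂ) := by rw [Rat.cast_neg, Complex.ofReal_ratCast]
    congr 1
    · by_cases h : (zdGraph 2).Adj (xs i) (xs j)
      · rw [if_pos h, Finset.smul_sum]
        refine Finset.sum_congr rfl fun σ _ => ?_
        rw [if_pos (hadj1.2 h), ec1]
      · rw [if_neg h, Finset.sum_eq_zero fun σ _ => by rw [if_neg (fun h' => h (hadj1.1 h'))], smul_zero]
    · by_cases h : diagAdjB (xs i) (xs j) = true
      · rw [if_pos h, Finset.smul_sum]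
        refine Finset.sum_congr rfl fun σ _ => ?_
        rw [if_pos (hadj2.2 h), ec2]
      · rw [if_neg h, Finset.sum_eq_zero fun σ _ => by rw [if_neg (fun h' => h (hadj2.1 h'))], smul_zero]
  -- on-site part
  have hons : ∑ i : Fin N, termOp d [([(orb i 0, true), (orb i 0, false), (orb i 1, true), (orb i 1, false)], U)] =
      (((U : ℚ) : ℝ) : ℂ) • ∑ x : PolySite Λ', numberOp x 0 * numberOp x 1 := by
    rw [Finset.smul_sum, ← hebij.sum_comp (fun x => (((U : ℚ) : ℝ) : ℂ) • (numberOp x 0 * numberOp x 1))]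
    refine Finset.sum_congr rfl fun i _ => ?_
    rw [termOp_onSite xs hmem d hd, Complex.ofReal_ratCast]
  rw [hhop, hons]
  abel

end Dictionary

end CARPolyWindow

end Summit.Ventures.CertifiedManyBodySolver

end
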